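import Literature.Barriers.CriticalPhenomena.WeaklySAWFiniteVolume
import Literature.Barriers.CriticalPhenomena.WeaklySAWTorusFeynmanKac
import Mathlib.Analysis.SpecialFunctions.Gaussian.FourierTransform
import Mathlib.MeasureTheory.Integral.Pi
import HarnessLib

/-!
# The Gaussian–Fourier decomposition of the weak self-avoidance per skeleton:
# `∫ ρ_g^{⊗Λ}(w) Π_i (a + iw_{x̄ᵢ})⁻¹ dw = ∫_{(0,∞)^{k+1}} e^{-aΣσ - gΣ_x L_x(σ)²} dσ`

Third file of the series formalising Proposition 3.1 of Bauerschmidt–Brydges–Slade, CMP 337 (2015),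
arXiv:1403.7422 — the supersymmetric integral representation
`G_{N,g,ν}(a,b) = ∫ e^{-Σ_x(τ_{Δ,x} + gτ_x² + ντ_x)} φ̄_a φ_b` — along the self-contained proof of
[BIS09] (Brydges–Imbrie–Slade, Probab. Surveys 6 (2009), arXiv:0906.0922), Proposition 4.4 /
Theorem 5.1: the function `F(t) = e^{-gΣt_x² - νΣt_x}` of the local times is Fourier-decomposed into
exponentials `e^{-Σ(ν+iv_x)t_x}`, for which both sides are resolvents of `-Δ + ν + iV`.

For this particular `F` the Fourier decomposition is explicit and Gaussian, site by site:
`e^{-gL²} = ∫ ρ_g(w) e^{-iwL} dw`, `ρ_g(w) = (4πg)^{-1/2}e^{-w²/(4g)}`. This file proves the resulting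
PER-SKELETON identity and the walk-side bookkeeping; the form side and the assembly are in the sequel.

* `gaussDensity g = ρ_g` (`> 0`, continuous, integrable) and **`integral_gaussDensity_mul_cexp`**:
  `∫ ρ_g(w) e^{-iwL} dw = e^{-gL²}` (Mathlib's `integral_cexp_quadratic`);
* `integral_Ioi_cexp_neg_mul`: `∫₀^∞ e^{-as} ds = a⁻¹` for `Re a > 0`;
* for a class sequence `c : Fin (k+1) → Λ` (`c i = ω(i) mod n`): `classLocalTime c x σ = L_x(σ)`,
  `sum_mul_eq_sum_mul_classLocalTime` (`Σ_i w_{cᵢ}σᵢ = Σ_x w_xL_x`), `sum_sq_classLocalTime`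
  (`Σ_xL_x² = Σ_{i,j: cᵢ=cⱼ}σᵢσⱼ`), the complex skeleton weight `skelWeight c a w = Π_i(a+iw_{cᵢ})⁻¹`,
  the real skeleton integral `skelIntegral c a g = ∫_{(0,∞)^{k+1}}e^{-aΣσ-gΣ_xL_x(σ)²}dσ`,
  `skelWeight_eq_integral` (`= ∫_{(0,∞)^{k+1}}Π_ie^{-(a+iw_{cᵢ})σᵢ}dσ`) and the main
  **`integral_gaussDensity_mul_skelWeight`**:
  `∫_{ℝ^Λ} Π_xρ_g(w_x)·Π_i(a+iw_{cᵢ})⁻¹ dw = ∫_{(0,∞)^{k+1}} e^{-aΣσ-gΣ_xL_x(σ)²} dσ`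
  (Fubini, absolute integrability, and the site-by-site Gaussian Fourier transform); `ℕ`-indexed
  variants `skelWeightN`, `skelIntegralN` (to transport along walks of prescribed length);
* walk side: `lintegral_Ioi_torusPathIntegral_eq` (the time-integrated, `e^{-νT}`-weighted torus path
  integral of a skeleton IS `skelIntegralN`, via the volume-preserving sojourn map of
  `WeaklySAWSojournSimplex.lean`) and **`torusTwoPoint_eq_tsum_stepSeq`**:
  `G_{N,ν}(0,b) = Σ_k Σ_{e : k steps} 𝟙{ē(k)=b}·skelIntegralN k (ē) (2d+ν) g` in `[0,∞]` (`g ≥ 0`,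
  `2d + ν > 0`), the walks of `ℤ^d` re-indexed by step sequences (`SRW.sum_walks_eq_sum_stepSeq`).

Everything is proved; no named facts.
-/

noncomputable section

open MeasureTheory Filter Topology Set Complex
open Literature.Probability.LatticeModels
open scoped BigOperators

namespace Literature.Barriers.CriticalPhenomena

namespace CTWSAW

/-! ### The Gaussian density `ρ_g` and its Fourier transform `e^{-gL²}` -/

section Gaussian

variable {g : ℝ}

/-- The centred Gaussian density of variance `2g`: `ρ_g(w) = (4πg)^{-1/2} e^{-w²/(4g)}`, chosen so
that `∫ ρ_g(w) e^{-iwL} dw = e^{-gL²}` — the superposition of imaginary "killing rates" reproducing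
the weak self-avoidance factor `e^{-gL²}` of a local time `L`. [folklore] -/
def gaussDensity (g w : ℝ) : ℝ := (Real.sqrt (4 * Real.pi * g))⁻¹ * Real.exp (-(w ^ 2 / (4 * g)))

/-- `ρ_g > 0`. [folklore] -/
theorem gaussDensity_pos (hg : 0 < g) (w : ℝ) : 0 < gaussDensity g w := by
  unfold gaussDensity; positivity

/-- `ρ_g` is continuous. [folklore] -/
theorem continuous_gaussDensity (g : ℝ) : Continuous (gaussDensity g) := by
  unfold gaussDensity; fun_prop

/-- `ρ_g` is integrable. [folklore] -/
theorem integrable_gaussDensity (hg : 0 < g) : Integrable (gaussDensity g) := by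
  unfold gaussDensity
  have h : Integrable fun w : ℝ => Real.exp (-(4 * g)⁻¹ * w ^ 2) :=
    integrable_exp_neg_mul_sq (by positivity)
  refine (h.const_mul (Real.sqrt (4 * Real.pi * g))⁻¹).congr (Eventually.of_forall fun w => ?_)
  simp only; congr 1; congr 1; field_simp

/-- **`∫ ρ_g(w) e^{-iwL} dw = e^{-gL²}`** for real `L` (Fourier transform of the Gaussian; Mathlib's
`integral_cexp_quadratic`). [folklore] -/
theorem integral_gaussDensity_mul_cexp (hg : 0 < g) (L : ℝ) :
    ∫ w : ℝ, (gaussDensity g w : ℂ) * cexp (-I * w * L) = (Real.exp (-(g * L ^ 2)) : ℂ) := by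
  have hb : (-(1 / (4 * (g : ℂ)))).re < 0 := by
    have : (-(1 / (4 * (g : ℂ)))) = ((-(1 / (4 * g)) : ℝ) : ℂ) := by push_cast; ring
    rw [this, Complex.ofReal_re]
    have : 0 < 1 / (4 * g) := by positivity
    linarith
  have h := integral_cexp_quadratic hb (-I * L) 0
  have hπ : (Real.pi : ℂ) / -(-(1 / (4 * (g : ℂ)))) = ((4 * Real.pi * g : ℝ) : ℂ) := by
    have hg' : (g : ℂ) ≠ 0 := by exact_mod_cast hg.ne'
    push_cast; field_simp
  have hsq : ((Real.pi : ℂ) / -(-(1 / (4 * (g : ℂ))))) ^ (1 / 2 : ℂ) = (Real.sqrt (4 * Real.pi * g) : ℂ) := by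
    rw [hπ, Real.sqrt_eq_rpow, Complex.ofReal_cpow (by positivity)]
    norm_num
  have hexp : (0 : ℂ) - (-I * L) ^ 2 / (4 * -(1 / (4 * (g : ℂ)))) = ((-(g * L ^ 2) : ℝ) : ℂ) := by
    have hg' : (g : ℂ) ≠ 0 := by exact_mod_cast hg.ne'
    push_cast
    field_simp
    rw [Complex.I_sq]; ring
  rw [hsq, hexp, ← Complex.ofReal_exp] at h
  -- `h : ∫ cexp(b w² - iLw) = √(4πg) e^{-gL²}`; divide by `√(4πg)`
  have hsqrt : (Real.sqrt (4 * Real.pi * g) : ℂ) ≠ 0 := by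
    exact_mod_cast (Real.sqrt_pos.2 (by positivity)).ne'
  have hfun : (fun w : ℝ => (gaussDensity g w : ℂ) * cexp (-I * w * L)) =
      fun w : ℝ => ((Real.sqrt (4 * Real.pi * g))⁻¹ : ℂ) *
        cexp (-(1 / (4 * (g : ℂ))) * (w : ℂ) ^ 2 + -I * L * w + 0) := by
    funext w
    rw [gaussDensity]
    push_cast
    rw [mul_assoc, ← Complex.exp_add]
    congr 2
    have hg' : (g : ℂ) ≠ 0 := by exact_mod_cast hg.ne'
    field_simp; ring
  rw [hfun, integral_const_mul, h]
  field_simp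

end Gaussian

/-! ### `(a + iw)⁻¹ = ∫₀^∞ e^{-(a+iw)s} ds` -/

/-- `∫₀^∞ e^{-as} ds = a⁻¹` for `Re a > 0` (complex). [folklore] -/
theorem integral_Ioi_cexp_neg_mul {a : ℂ} (ha : 0 < a.re) :
    ∫ s in Ioi (0 : ℝ), cexp (-a * s) = a⁻¹ := by
  have h := integral_exp_mul_complex_Ioi (a := -a) (by simpa using ha) 0
  simp only [Complex.ofReal_zero, mul_zero, Complex.exp_zero] at h
  rw [h]; field_simp

/-- Integrability of `e^{-as}` on `(0,∞)` for `Re a > 0`. [folklore] -/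
theorem integrableOn_cexp_neg_mul {a : ℂ} (ha : 0 < a.re) :
    IntegrableOn (fun s : ℝ => cexp (-a * s)) (Ioi 0) := by
  have h := integrableOn_exp_mul_complex_Ioi (a := -a) (by simpa using ha) 0
  exact h


/-! ### Local times of a class sequence and the per-skeleton identity -/

section Skeleton

variable {Λ : Type*} [Fintype Λ] [DecidableEq Λ] {k : ℕ}

/-- The local time `L_x(σ) = Σ_{i : c i = x} σ_i` spent in the class `x` by a skeleton with class
sequence `c` (`c i = ω(i) mod n`) and sojourn times `σ`. [cite: BrydgesImbrieSlade2009, §2.2 (L_{x,T} = ∫₀ᵀ 𝟙_{X(s)=x} ds)] -/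
def classLocalTime (c : Fin (k + 1) → Λ) (x : Λ) (σ : Fin (k + 1) → ℝ) : ℝ :=
  ∑ i, if c i = x then σ i else 0

/-- `Σ_i w_{c i} σ_i = Σ_x w_x L_x(σ)`. [folklore] -/
theorem sum_mul_eq_sum_mul_classLocalTime (c : Fin (k + 1) → Λ) (w : Λ → ℝ) (σ : Fin (k + 1) → ℝ) :
    ∑ i, w (c i) * σ i = ∑ x, w x * classLocalTime c x σ := by
  simp only [classLocalTime, Finset.mul_sum, mul_ite, mul_zero]
  rw [Finset.sum_comm]
  refine Finset.sum_congr rfl fun i _ => ?_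
  rw [Finset.sum_ite_eq]
  simp

/-- `Σ_x L_x(σ)² = Σ_{i,j : c i = c j} σ_i σ_j` (the self-intersection local time). [cite: BauerschmidtBrydgesSlade2015LogCorr, §1.1 (I(T) = Σ_x (L^x_T)²)] -/
theorem sum_sq_classLocalTime (c : Fin (k + 1) → Λ) (σ : Fin (k + 1) → ℝ) :
    ∑ x, classLocalTime c x σ ^ 2 = ∑ i, ∑ j, if c i = c j then σ i * σ j else 0 := by
  simp only [classLocalTime, sq, Finset.sum_mul_sum]
  rw [Finset.sum_comm]
  refine Finset.sum_congr rfl fun i _ => ?_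
  rw [Finset.sum_comm]
  refine Finset.sum_congr rfl fun j _ => ?_
  have h1 : ∀ y, ((if c i = y then σ i else 0) * if c j = y then σ j else 0) =
      if c i = y then (if c j = c i then σ i * σ j else 0) else 0 := by
    intro y
    by_cases hi : c i = y
    · subst hi; simp
    · simp [hi]
  simp_rw [h1]
  rw [Finset.sum_ite_eq]
  simp [eq_comm]

/-- The complex skeleton weight `Π_{i ≤ k} (a + i w_{c i})⁻¹` — the `k`-jump term of the resolvent of
`-Δ + a + iW` along a skeleton with class sequence `c`. [cite: BrydgesImbrieSlade2009, eq. (Gsrw) (Π d_{ω(i)}⁻¹) with Theorem 2.6 / Proposition 4.4 (v_x ↦ -iv_x + ε)] -/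
def skelWeight (c : Fin (k + 1) → Λ) (a : ℝ) (w : Λ → ℝ) : ℂ := ∏ i, ((a : ℂ) + I * w (c i))⁻¹

/-- The real skeleton integral `∫_{(0,∞)^{k+1}} e^{-aΣσ - gΣ_x L_x(σ)²} dσ` — the time-integrated
weakly self-avoiding weight of the skeleton (free sojourns). [cite: BauerschmidtBrydgesSlade2015LogCorr, §1.1 (c_T, χ) with Appendix A (free sojourn representation)] -/
def skelIntegral (c : Fin (k + 1) → Λ) (a g : ℝ) : ℝ :=
  ∫ σ in Set.pi univ (fun _ => Ioi (0 : ℝ)),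
    Real.exp (-(a * ∑ i, σ i) - g * ∑ x, classLocalTime c x σ ^ 2)

/-- The restricted Lebesgue measure on the open orthant is the product of the half-line measures.
[folklore] -/
theorem volume_restrict_pi_Ioi (m : ℕ) :
    (volume : Measure (Fin m → ℝ)).restrict (Set.pi univ fun _ => Ioi (0 : ℝ)) =
      Measure.pi fun _ : Fin m => (volume : Measure ℝ).restrict (Ioi 0) := by
  rw [volume_pi, Measure.restrict_pi_pi]

omit [Fintype Λ] [DecidableEq Λ] in
/-- **`Π_i (a + iw_{cᵢ})⁻¹ = ∫_{(0,∞)^{k+1}} Π_i e^{-(a + iw_{cᵢ})σᵢ} dσ`** (`a > 0`): each factor is a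
half-line exponential integral. [cite: BrydgesImbrieSlade2009, Theorem 2.5 (proof: the conditional expectation of e^{-Σ v σ} over independent exponential holding times)] -/
theorem skelWeight_eq_integral (c : Fin (k + 1) → Λ) {a : ℝ} (ha : 0 < a) (w : Λ → ℝ) :
    skelWeight c a w = ∫ σ in Set.pi univ (fun _ => Ioi (0 : ℝ)),
      ∏ i, cexp (-((a : ℂ) + I * w (c i)) * σ i) := by
  rw [volume_restrict_pi_Ioi, integral_fintype_prod_eq_prod
    (f := fun i (s : ℝ) => cexp (-((a : ℂ) + I * w (c i)) * s))]
  unfold skelWeight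
  refine Finset.prod_congr rfl fun i _ => ?_
  rw [integral_Ioi_cexp_neg_mul]
  simp [ha]

/-- The norm of a factor: `|e^{-(a+iw)s}| = e^{-as}`. [folklore] -/
theorem norm_cexp_neg_add_mul (a w s : ℝ) : ‖cexp (-((a : ℂ) + I * w) * s)‖ = Real.exp (-(a * s)) := by
  rw [Complex.norm_exp]
  congr 1
  simp [Complex.mul_re, Complex.add_re, Complex.mul_im]

/-- **The per-skeleton Gaussian–Fourier identity**: for `g > 0`, `a > 0`,
`∫_{ℝ^Λ} Π_x ρ_g(w_x) · Π_i (a + iw_{cᵢ})⁻¹ dw = ∫_{(0,∞)^{k+1}} e^{-aΣσ - gΣ_x L_x(σ)²} dσ` —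
Fubini and `∫ρ_g(w)e^{-iwL}dw = e^{-gL²}` site by site (`Σ_i w_{cᵢ}σᵢ = Σ_x w_x L_x(σ)`). This is the
mechanism of [BIS09, Proposition 4.4] (Fourier decomposition of `F(t)`, then the resolvent for the
potential `-iv + ε`) specialised to `F(t) = e^{-gΣt_x²}` where the Fourier transform is explicit.
[cite: BrydgesImbrieSlade2009, Proposition 4.4 (proof of (FDynkin))] -/
theorem integral_gaussDensity_mul_skelWeight {g a : ℝ} (hg : 0 < g) (ha : 0 < a)
    (c : Fin (k + 1) → Λ) :
    ∫ w : Λ → ℝ, (∏ x, (gaussDensity g (w x) : ℂ)) * skelWeight c a w = (skelIntegral c a g : ℂ) := by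
  set μσ : Measure (Fin (k + 1) → ℝ) := (volume : Measure (Fin (k + 1) → ℝ)).restrict
    (Set.pi univ fun _ => Ioi (0 : ℝ)) with hμσ
  set G : (Λ → ℝ) → (Fin (k + 1) → ℝ) → ℂ := fun w σ =>
    (∏ x, (gaussDensity g (w x) : ℂ)) * ∏ i, cexp (-((a : ℂ) + I * w (c i)) * σ i) with hG
  -- Step 1: the left-hand side as an iterated integral
  have h1 : ∫ w : Λ → ℝ, (∏ x, (gaussDensity g (w x) : ℂ)) * skelWeight c a w =
      ∫ w : Λ → ℝ, ∫ σ, G w σ ∂μσ := by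
    refine integral_congr_ae (Eventually.of_forall fun w => ?_)
    simp only [hG]
    rw [integral_const_mul, skelWeight_eq_integral c ha w]
  -- Step 2: integrability on the product (the norm of the integrand factorises)
  have hρint : Integrable (fun w : Λ → ℝ => ∏ x, gaussDensity g (w x)) := by
    have := Integrable.fintype_prod (𝕜 := ℝ) (μ := fun _ : Λ => (volume : Measure ℝ))
      (f := fun (_ : Λ) (t : ℝ) => gaussDensity g t) fun _ => integrable_gaussDensity hg
    rw [← volume_pi] at this
    exact this
  have hexpint : Integrable (fun σ : Fin (k + 1) → ℝ => ∏ i, Real.exp (-(a * σ i))) μσ := by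
    rw [hμσ, volume_restrict_pi_Ioi]
    refine Integrable.fintype_prod (𝕜 := ℝ)
      (f := fun (_ : Fin (k + 1)) (s : ℝ) => Real.exp (-(a * s))) fun _ => ?_
    have h := exp_neg_integrableOn_Ioi 0 ha
    refine h.congr (Eventually.of_forall fun s => ?_)
    simp [neg_mul]
  have hGint : Integrable (Function.uncurry G) ((volume : Measure (Λ → ℝ)).prod μσ) := by
    have hB := hρint.mul_prod hexpint
    refine hB.mono' ?_ (Eventually.of_forall fun p => ?_)
    · have : Continuous (Function.uncurry G) := by
        simp only [hG, Function.uncurry_def]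
        refine Continuous.mul ?_ ?_
        · refine continuous_finsetProd _ fun x _ => ?_
          exact Complex.continuous_ofReal.comp ((continuous_gaussDensity g).comp
            ((continuous_apply x).comp continuous_fst))
        · refine continuous_finsetProd _ fun i _ => ?_
          fun_prop
      exact this.aestronglyMeasurable
    · rcases p with ⟨w, σ⟩
      simp only [Function.uncurry_apply_pair, hG, norm_mul, norm_prod]
      refine le_of_eq ?_
      congr 1
      · refine Finset.prod_congr rfl fun x _ => ?_
        rw [Complex.norm_real, Real.norm_of_nonneg (gaussDensity_pos hg _).le]
      · refine Finset.prod_congr rfl fun i _ => ?_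
        rw [norm_cexp_neg_add_mul]
  -- Step 3: swap
  rw [h1, integral_integral_swap hGint]
  -- Step 4: the inner `w`-integral, site by site
  have h4 : ∀ σ : Fin (k + 1) → ℝ, ∫ w : Λ → ℝ, G w σ =
      ((Real.exp (-(a * ∑ i, σ i) - g * ∑ x, classLocalTime c x σ ^ 2) : ℝ) : ℂ) := by
    intro σ
    have hfac : ∀ w : Λ → ℝ, G w σ = (Real.exp (-(a * ∑ i, σ i)) : ℂ) *
        ∏ x, ((gaussDensity g (w x) : ℂ) * cexp (-I * w x * classLocalTime c x σ)) := by
      intro w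
      simp only [hG]
      have hsplit : ∀ i, cexp (-((a : ℂ) + I * w (c i)) * σ i) =
          cexp (-(a : ℂ) * σ i) * cexp (-I * (w (c i) * σ i)) := by
        intro i; rw [← Complex.exp_add]; congr 1; ring
      simp_rw [hsplit]
      rw [Finset.prod_mul_distrib, ← Complex.exp_sum, ← Complex.exp_sum, Finset.prod_mul_distrib,
        ← Complex.exp_sum]
      have hsum1 : ∑ i, -(a : ℂ) * σ i = ((-(a * ∑ i, σ i) : ℝ) : ℂ) := by
        push_cast; rw [Finset.mul_sum, ← Finset.sum_neg_distrib]
        exact Finset.sum_congr rfl fun i _ => by ring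
      have hsum2 : ∑ i, -I * ((w (c i) : ℂ) * σ i) = ∑ x, -I * w x * classLocalTime c x σ := by
        have h := sum_mul_eq_sum_mul_classLocalTime c w σ
        have h' : ∑ i, ((w (c i) : ℂ) * σ i) = ∑ x, (w x : ℂ) * classLocalTime c x σ := by
          have h2 := congrArg (fun r : ℝ => (r : ℂ)) h
          push_cast at h2
          exact h2
        rw [show ∑ i, -I * ((w (c i) : ℂ) * σ i) = -I * ∑ i, ((w (c i) : ℂ) * σ i) by
          rw [Finset.mul_sum], h', Finset.mul_sum]
        exact Finset.sum_congr rfl fun x _ => by ring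
      rw [hsum1, hsum2, Complex.ofReal_exp]
      ring
    simp_rw [hfac]
    rw [integral_const_mul, volume_pi, integral_fintype_prod_eq_prod
      (f := fun x (t : ℝ) => (gaussDensity g t : ℂ) * cexp (-I * t * classLocalTime c x σ))]
    simp_rw [integral_gaussDensity_mul_cexp hg]
    rw [← Complex.ofReal_prod, ← Complex.ofReal_mul, ← Real.exp_sum, ← Real.exp_add]
    congr 1
    rw [sub_eq_add_neg, Finset.mul_sum, ← Finset.sum_neg_distrib, Finset.mul_sum,
      ← Finset.sum_neg_distrib]
  simp_rw [h4]
  rw [integral_complex_ofReal]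
  rfl

end Skeleton


/-! ### `ℕ`-indexed class sequences (to transport along walks of a given length) -/

section NatIndexed

variable {Λ : Type*} [Fintype Λ] [DecidableEq Λ]

/-- `skelWeight` for an `ℕ`-indexed class sequence (only `c 0, …, c m` are used). [folklore] -/
def skelWeightN (m : ℕ) (c : ℕ → Λ) (a : ℝ) (w : Λ → ℝ) : ℂ := skelWeight (fun i : Fin (m + 1) => c i) a w

/-- `skelIntegral` for an `ℕ`-indexed class sequence. [folklore] -/
def skelIntegralN (m : ℕ) (c : ℕ → Λ) (a g : ℝ) : ℝ := skelIntegral (fun i : Fin (m + 1) => c i) a g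

omit [Fintype Λ] [DecidableEq Λ] in
/-- `skelWeightN` only depends on `c 0, …, c m`. [folklore] -/
theorem skelWeightN_congr (m : ℕ) {c c' : ℕ → Λ} (h : ∀ i ≤ m, c i = c' i) (a : ℝ) (w : Λ → ℝ) :
    skelWeightN m c a w = skelWeightN m c' a w := by
  unfold skelWeightN skelWeight
  refine Finset.prod_congr rfl fun i _ => ?_
  simp only [h i (Nat.lt_succ_iff.1 i.isLt)]

/-- `skelIntegralN` only depends on `c 0, …, c m`. [folklore] -/
theorem skelIntegralN_congr (m : ℕ) {c c' : ℕ → Λ} (h : ∀ i ≤ m, c i = c' i) (a g : ℝ) :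
    skelIntegralN m c a g = skelIntegralN m c' a g := by
  unfold skelIntegralN skelIntegral classLocalTime
  have : ∀ i : Fin (m + 1), c i = c' i := fun i => h i (Nat.lt_succ_iff.1 i.isLt)
  simp_rw [this]

/-- The per-skeleton identity, `ℕ`-indexed form. [cite: BrydgesImbrieSlade2009, Proposition 4.4 (proof of (FDynkin))] -/
theorem integral_gaussDensity_mul_skelWeightN {g a : ℝ} (hg : 0 < g) (ha : 0 < a) (m : ℕ)
    (c : ℕ → Λ) :
    ∫ w : Λ → ℝ, (∏ x, (gaussDensity g (w x) : ℂ)) * skelWeightN m c a w = (skelIntegralN m c a g : ℂ) :=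
  integral_gaussDensity_mul_skelWeight hg ha _

/-- The skeleton integral is non-negative. [folklore] -/
theorem skelIntegralN_nonneg (m : ℕ) (c : ℕ → Λ) (a g : ℝ) : 0 ≤ skelIntegralN m c a g :=
  setIntegral_nonneg (MeasurableSet.univ_pi fun _ => measurableSet_Ioi) fun _ _ => (Real.exp_pos _).le

end NatIndexed

/-! ### The walk side: `G_{N,ν}(0,b)` as a sum of skeleton integrals -/

section WalkSide

variable {d n : ℕ} {g : ℝ}

/-- The torus self-intersection local time of the jump-chain is `Σ_{i,j : x̄ᵢ = x̄ⱼ} σᵢσⱼ` of the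
sojourns, with classes `x̄ᵢ = ω(i) mod n`. [folklore] -/
theorem torusSelfIntersection_eq (T : ℝ) {x : Site d} (ω : (zdGraph d).Walk 0 x)
    (s : Fin ω.length → ℝ) :
    torusSelfIntersection n T ω s = ∑ i : Fin (ω.length + 1), ∑ j : Fin (ω.length + 1),
      if Torus.proj n (ω.getVert i) = Torus.proj n (ω.getVert j) then
        sojourns T s i * sojourns T s j else 0 := rfl

/-- **Time integration per skeleton, torus version**:
`∫₀^∞ e^{-2dT}(∫_{Δ_k(T)} e^{-gI_T(X^n)} ds)e^{-νT} dT = ∫_{(0,∞)^{k+1}} e^{-(2d+ν)Σσ - gΣ_x L_x(σ)²} dσ`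
as a non-negative extended real (`g ≥ 0`, `2d + ν > 0`). [cite: BauerschmidtBrydgesSlade2015LogCorr, Appendix A (free sojourn representation), as in the tree's lintegral_Ioi_pathIntegral_eq_gcTerm] -/
theorem lintegral_Ioi_torusPathIntegral_eq (hg : 0 ≤ g) {ν : ℝ} (hν : 0 < 2 * d + ν) {x : Site d}
    (ω : (zdGraph d).Walk 0 x) [NeZero n] :
    ∫⁻ T in Ioi 0, ENNReal.ofReal (Real.exp (-(2 * d) * T)) * torusPathIntegral n g T ω *
        ENNReal.ofReal (Real.exp (-ν * T)) =
      ENNReal.ofReal (skelIntegralN ω.length (fun i => Torus.proj n (ω.getVert i)) (2 * d + ν) g) := by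
  set c : Fin (ω.length + 1) → TorusSite d n := fun i => Torus.proj n (ω.getVert i) with hc
  set F : (Fin (ω.length + 1) → ℝ) → ℝ := fun σ =>
    Real.exp (-((2 * d + ν) * ∑ i, σ i) - g * ∑ x, classLocalTime c x σ ^ 2) with hF
  have hFcont : Continuous F := by
    simp only [hF, classLocalTime]
    refine Real.continuous_exp.comp (Continuous.sub (by fun_prop) (continuous_const.mul
      (continuous_finsetSum _ fun y _ => (continuous_finsetSum _ fun i _ => ?_).pow 2)))
    by_cases hci : c i = y
    · simp only [hci, if_true]; exact continuous_apply i
    · simp only [hci, if_false]; exact continuous_const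
  have hH : Measurable fun σ => ENNReal.ofReal (F σ) := hFcont.measurable.ennreal_ofReal
  rw [skelIntegralN, skelIntegral, ← hc]
  -- the time integral as an integral over free sojourns
  have h1 : ∫⁻ T in Ioi 0, ENNReal.ofReal (Real.exp (-(2 * d) * T)) * torusPathIntegral n g T ω *
      ENNReal.ofReal (Real.exp (-ν * T)) = ∫⁻ T in Ioi 0, ∫⁻ s in sojournSet ω.length T,
        ENNReal.ofReal (F (sojourns T s)) := by
    refine setLIntegral_congr_fun measurableSet_Ioi fun T _ => ?_
    unfold torusPathIntegral
    rw [← lintegral_const_mul' _ _ ENNReal.ofReal_ne_top, ← lintegral_mul_const' _ _ ENNReal.ofReal_ne_top]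
    refine setLIntegral_congr_fun (measurableSet_sojournSet _ _) fun s _ => ?_
    rw [← ENNReal.ofReal_mul (Real.exp_pos _).le, ← ENNReal.ofReal_mul (by positivity),
      ← Real.exp_add, ← Real.exp_add, hF]
    simp only
    congr 1
    rw [sum_sq_classLocalTime, hc, ← torusSelfIntersection_eq, sum_sojourns]
    ring
  rw [h1, lintegral_Ioi_lintegral_sojournSet hH]
  -- `∫⁻ ofReal F = ofReal ∫ F` on the orthant (`F ≥ 0` integrable)
  have hint : IntegrableOn F (Set.pi univ fun _ => Ioi (0 : ℝ)) := by
    have hdom : IntegrableOn (fun σ : Fin (ω.length + 1) → ℝ => ∏ i, Real.exp (-((2 * d + ν) * σ i)))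
        (Set.pi univ fun _ => Ioi (0 : ℝ)) := by
      rw [IntegrableOn, volume_restrict_pi_Ioi]
      refine Integrable.fintype_prod (𝕜 := ℝ)
        (f := fun (_ : Fin (ω.length + 1)) (t : ℝ) => Real.exp (-((2 * d + ν) * t))) fun _ => ?_
      have h := exp_neg_integrableOn_Ioi 0 hν
      refine h.congr (Eventually.of_forall fun t => ?_)
      simp only; congr 1; ring
    refine hdom.mono' hFcont.aestronglyMeasurable ?_
    refine (ae_restrict_mem (MeasurableSet.univ_pi fun _ => measurableSet_Ioi)).mono fun σ _ => ?_
    rw [Real.norm_eq_abs, abs_of_pos (Real.exp_pos _)]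
    rw [← Real.exp_sum]
    refine Real.exp_le_exp.2 ?_
    have hsq : 0 ≤ g * ∑ x, classLocalTime c x σ ^ 2 :=
      mul_nonneg hg (Finset.sum_nonneg fun _ _ => sq_nonneg _)
    have hsum : ∑ i, -((2 * d + ν) * σ i) = -((2 * d + ν) * ∑ i, σ i) := by
      rw [Finset.mul_sum, Finset.sum_neg_distrib]
    rw [hsum]
    linarith
  rw [← ofReal_integral_eq_lintegral_ofReal hint
    ((ae_restrict_mem (MeasurableSet.univ_pi fun _ => measurableSet_Ioi)).mono
      fun σ _ => (Real.exp_pos _).le)]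

/-- Measurability in `T` of the doubly weighted torus path integral. [folklore] -/
theorem measurable_torusPathIntegral_weighted (g ν : ℝ) {x : Site d} (ω : (zdGraph d).Walk 0 x) :
    Measurable fun T : ℝ => ENNReal.ofReal (Real.exp (-(2 * d) * T)) * torusPathIntegral n g T ω *
      ENNReal.ofReal (Real.exp (-ν * T)) :=
  (((Real.continuous_exp.comp (continuous_const.mul continuous_id)).measurable.ennreal_ofReal).mul
    (measurable_torusPathIntegral n g ω)).mul
    (Real.continuous_exp.comp (continuous_const.mul continuous_id)).measurable.ennreal_ofReal

open Literature.Probability.LatticeModels.SRW (StepSeq pos endpoint toWalk length_toWalk getVert_toWalk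
  sum_walks_eq_sum_stepSeq) in
/-- **The torus two-point function as a sum over step sequences of skeleton integrals**:
`G_{N,ν}(0,b) = Σ_k Σ_{e : k steps} 𝟙{ē(k) = b} ∫_{(0,∞)^{k+1}} e^{-(2d+ν)Σσ - gΣ_x L_x(σ)²} dσ`
(`g ≥ 0`, `2d + ν > 0`; in `[0,∞]`). [cite: BauerschmidtBrydgesSlade2015LogCorr, §2 (definition of G_{N,ν}) with Appendix A (free sojourns)] -/
theorem torusTwoPoint_eq_tsum_stepSeq [NeZero n] (hg : 0 ≤ g) {ν : ℝ} (hν : 0 < 2 * d + ν)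
    (b : TorusSite d n) :
    torusTwoPoint d n g ν b = ∑' k, ∑ e : StepSeq d k,
      ENNReal.ofReal ((if Torus.proj n (endpoint e) = b then (1 : ℝ) else 0) *
        skelIntegralN k (fun i => Torus.proj n (pos e i)) (2 * d + ν) g) := by
  classical
  unfold torusTwoPoint torusSurvivalAt torusWeightedExpectation
  -- move the two scalar weights inside the sums
  have h1 : ∀ T : ℝ, ENNReal.ofReal (Real.exp (-(2 * d) * T)) *
      (∑' k : ℕ, ∑ x ∈ box d k, ∑ ω ∈ (zdGraph d).finsetWalkLength k (0 : Site d) x,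
        (if Torus.proj n x = b then 1 else 0) * torusPathIntegral n g T ω) *
      ENNReal.ofReal (Real.exp (-ν * T)) =
      ∑' k : ℕ, ∑ x ∈ box d k, ∑ ω ∈ (zdGraph d).finsetWalkLength k (0 : Site d) x,
        (if Torus.proj n x = b then 1 else 0) * (ENNReal.ofReal (Real.exp (-(2 * d) * T)) *
          torusPathIntegral n g T ω * ENNReal.ofReal (Real.exp (-ν * T))) := by
    intro T
    rw [← ENNReal.tsum_mul_left, ← ENNReal.tsum_mul_right]
    refine tsum_congr fun k => ?_
    rw [Finset.mul_sum, Finset.sum_mul]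
    refine Finset.sum_congr rfl fun x _ => ?_
    rw [Finset.mul_sum, Finset.sum_mul]
    refine Finset.sum_congr rfl fun ω _ => ?_
    ring
  simp_rw [h1]
  rw [lintegral_tsum fun k => (Finset.measurable_sum _ fun x _ => Finset.measurable_sum _ fun ω _ =>
    (measurable_torusPathIntegral_weighted g ν ω).const_mul _).aemeasurable]
  refine tsum_congr fun k => ?_
  rw [lintegral_finsetSum _ fun x _ => Finset.measurable_sum _ fun ω _ =>
    (measurable_torusPathIntegral_weighted g ν ω).const_mul _]
  simp_rw [lintegral_finsetSum _ fun ω _ => (measurable_torusPathIntegral_weighted g ν ω).const_mul _]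
  simp_rw [lintegral_const_mul _ (measurable_torusPathIntegral_weighted g ν _),
    lintegral_Ioi_torusPathIntegral_eq hg hν]
  rw [sum_walks_eq_sum_stepSeq (fun x (ω : (zdGraph d).Walk (0 : Site d) x) =>
    (if Torus.proj n x = b then (1 : ENNReal) else 0) *
      ENNReal.ofReal (skelIntegralN ω.length (fun i => Torus.proj n (ω.getVert i)) (2 * d + ν) g))]
  refine Finset.sum_congr rfl fun e _ => ?_
  rw [length_toWalk, skelIntegralN_congr k (fun i hi => by rw [getVert_toWalk e hi]) (2 * d + ν) g]
  by_cases hb : Torus.proj n (endpoint e) = b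
  · simp [hb]
  · simp [hb]

end WalkSide

end CTWSAW

end Literature.Barriers.CriticalPhenomena
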